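import Summits.HodgeConjecture.HodgeConjecture.Theorems.SignSymmetricPowersNodalFormsTools

/-!
# K1-B nodal forms (route `SignSymmetricPowers`, item stmt-HodgeConjecture-19716) — the L-node witness

Helper file for the registered stub `stub_signNodalForms` (K1-B line `andre-zariski` v9/v10, WANTED
P3-W8; second conjunct): for every even `d = m + 4 ≥ 4` an explicit ι-even quinary form of degree `d` whose
projective hypersurface has exactly ONE singular point, an ordinary double point at
`e₀ = [1:0:0:0:0] ∈ L = {x₂ = x₃ = x₄ = 0}`. Landed `--supports stmt-HodgeConjecture-19716` as a helper; the
stub itself is assembled in `SignSymmetricPowersNodalForms.lean`. Sorry-free; axioms standard.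

## The witness (a SPLIT variant of the blueprint `memos/K1B-NODAL-FORMS-g22.md` §(L))

`f = x₀^{m+2} ((x₁ + x₄)(x₁ - x₄) + x₂ x₃) + (x₁ + x₄)^{m+4} + (x₁ - x₄)^{m+4} + x₂^{m+4} + 2 x₃^{m+4}`:
the Π-type split witness in the coordinates `u_± = x₁ ± x₄` (ι acts by `u₊ ↦ -u₋`, so the form is
ι-even although `u_±` are not eigenvectors).

* ι-even: invariance under `(x₀, x₁) ↦ (-x₀, -x₁)` (`coeff_eq_zero_of_sign_aeval_eq`; `m + 4` even).
* gradient (`pderiv_lineForm`) and its vanishing at `e₀`; Hessian at `e₀` = `diag(0, 2, [x₂ ↔ x₃], -2)`,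
  rank `4` (`rank_eq_four`: square `diag(0,4,1,1,4)`, kernel `∋ e₀`).
* ONLY singular point, algebraically: if `z₀ = 0` the equations force `z = 0`; if `z₀ ≠ 0` then
  `u₊u₋ + z₂z₃ = 0` (from `∂₀f`) and `(∂₁f ± ∂₄f)/2`, `∂₂f`, `∂₃f` form the split system of
  `split_pair_eq_zero` in `(u₊, u₋, z₂, z₃)` with `w = z₀^{m+2}` and `1 · 1 ≠ 1 · 2`; so
  `u₊ = u₋ = z₂ = z₃ = 0`, i.e. `z = z₀ • e₀`.
-/

set_option linter.dupNamespace false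

noncomputable section

namespace Summit.HodgeConjecture.HodgeConjecture.Theorems.SignSymmetricPowersNodalFormLine

open MvPolynomial Literature.AlgebraicGeometry.Motives Literature.AlgebraicGeometry.HodgeTheory
open Summit.HodgeConjecture.HodgeConjecture.Theorems.SignSymmetricPowersNodalFormsTools

/-- The gradient of the L-witness (closed form of the five partial derivatives). -/
theorem pderiv_lineForm (m : ℕ) :
    let f : MvPolynomial (Fin 5) ℂ := X 0 ^ (m + 2) * ((X 1 + X 4) * (X 1 - X 4) + X 2 * X 3) +
      (X 1 + X 4) ^ (m + 4) + (X 1 - X 4) ^ (m + 4) + X 2 ^ (m + 4) + C 2 * X 3 ^ (m + 4)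
    pderiv 0 f = C ((m : ℂ) + 2) * X 0 ^ (m + 1) * ((X 1 + X 4) * (X 1 - X 4) + X 2 * X 3) ∧
    pderiv 1 f = C 2 * X 0 ^ (m + 2) * X 1 + C ((m : ℂ) + 4) * (X 1 + X 4) ^ (m + 3) +
      C ((m : ℂ) + 4) * (X 1 - X 4) ^ (m + 3) ∧
    pderiv 2 f = X 0 ^ (m + 2) * X 3 + C ((m : ℂ) + 4) * X 2 ^ (m + 3) ∧
    pderiv 3 f = X 0 ^ (m + 2) * X 2 + C (2 * ((m : ℂ) + 4)) * X 3 ^ (m + 3) ∧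
    pderiv 4 f = -(C 2 * X 0 ^ (m + 2) * X 4) + C ((m : ℂ) + 4) * (X 1 + X 4) ^ (m + 3) -
      C ((m : ℂ) + 4) * (X 1 - X 4) ^ (m + 3) := by
  intro f
  refine ⟨?_, ?_, ?_, ?_, ?_⟩ <;>
  · simp +decide only [f, map_add, map_sub, Derivation.leibniz, Derivation.leibniz_pow, pderiv_X, pderiv_C,
      Pi.single_apply, smul_eq_mul, mul_zero, add_zero, sub_zero, Nat.add_succ_sub_one, if_true, if_false,
      nsmul_eq_mul, Nat.cast_add, Nat.cast_ofNat, mul_one]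
    simp only [map_add, map_mul, map_natCast, map_ofNat]
    ring

/-- The gradient of the L-witness as a vector of closed forms. -/
theorem pderiv_lineForm_eq (m : ℕ) (j : Fin 5) :
    pderiv j (X 0 ^ (m + 2) * ((X 1 + X 4) * (X 1 - X 4) + X 2 * X 3) + (X 1 + X 4) ^ (m + 4) +
        (X 1 - X 4) ^ (m + 4) + X 2 ^ (m + 4) + C 2 * X 3 ^ (m + 4) : MvPolynomial (Fin 5) ℂ) =
      (![C ((m : ℂ) + 2) * X 0 ^ (m + 1) * ((X 1 + X 4) * (X 1 - X 4) + X 2 * X 3),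
          C 2 * X 0 ^ (m + 2) * X 1 + C ((m : ℂ) + 4) * (X 1 + X 4) ^ (m + 3) +
            C ((m : ℂ) + 4) * (X 1 - X 4) ^ (m + 3),
          X 0 ^ (m + 2) * X 3 + C ((m : ℂ) + 4) * X 2 ^ (m + 3),
          X 0 ^ (m + 2) * X 2 + C (2 * ((m : ℂ) + 4)) * X 3 ^ (m + 3),
          -(C 2 * X 0 ^ (m + 2) * X 4) + C ((m : ℂ) + 4) * (X 1 + X 4) ^ (m + 3) -
            C ((m : ℂ) + 4) * (X 1 - X 4) ^ (m + 3)] : Fin 5 → MvPolynomial (Fin 5) ℂ) j := by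
  obtain ⟨h0, h1, h2, h3, h4⟩ := pderiv_lineForm m
  fin_cases j
  exacts [h0, h1, h2, h3, h4]

/-- The Hessian of the L-witness at `e₀` has rank `4`. -/
theorem rank_hessian_lineForm (m : ℕ) :
    (Matrix.of fun i j : Fin 5 => eval (![1, 0, 0, 0, 0] : Fin 5 → ℂ)
      (pderiv i (pderiv j (X 0 ^ (m + 2) * ((X 1 + X 4) * (X 1 - X 4) + X 2 * X 3) + (X 1 + X 4) ^ (m + 4) +
        (X 1 - X 4) ^ (m + 4) + X 2 ^ (m + 4) + C 2 * X 3 ^ (m + 4) : MvPolynomial (Fin 5) ℂ)))).rank = 4 := by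
  have hM : (Matrix.of fun i j : Fin 5 => eval (![1, 0, 0, 0, 0] : Fin 5 → ℂ)
      (pderiv i (pderiv j (X 0 ^ (m + 2) * ((X 1 + X 4) * (X 1 - X 4) + X 2 * X 3) + (X 1 + X 4) ^ (m + 4) +
        (X 1 - X 4) ^ (m + 4) + X 2 ^ (m + 4) + C 2 * X 3 ^ (m + 4) : MvPolynomial (Fin 5) ℂ)))) =
      !![0, 0, 0, 0, 0; 0, 2, 0, 0, 0; 0, 0, 0, 1, 0; 0, 0, 1, 0, 0; 0, 0, 0, 0, -2] := by
    ext i j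
    rw [Matrix.of_apply, pderiv_lineForm_eq m j]
    fin_cases i <;> fin_cases j <;> simp [Derivation.leibniz, Derivation.leibniz_pow, pderiv_X, map_sub]
  rw [hM]
  refine rank_eq_four (v := ![1, 0, 0, 0, 0]) (A := 1)
    (B := !![0, 0, 0, 0, 0; 0, 2, 0, 0, 0; 0, 0, 0, 1, 0; 0, 0, 1, 0, 0; 0, 0, 0, 0, -2])
    (w := ![0, 4, 1, 1, 4]) (fun h => by simpa using congr_fun h 0) ?_ ?_ 0 ?_
  · ext i; fin_cases i <;> simp [Matrix.mulVec, dotProduct, Fin.sum_univ_five]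
  · ext i j
    fin_cases i <;> fin_cases j <;> simp [Matrix.mul_apply, Fin.sum_univ_five] <;> norm_num
  · intro i; fin_cases i <;> simp

/-- **Uniqueness of the singular point of the L-witness** (the algebraic argument through the split system
in `u_± = z₁ ± z₄`): a non-zero `z` at which the gradient vanishes is a multiple of `e₀`. -/
theorem eq_smul_of_grad_lineForm (m : ℕ) (hm : Even m) (z : Fin 5 → ℂ) (hz : z ≠ 0)
    (hgrad : ∀ j, eval z (pderiv j (X 0 ^ (m + 2) * ((X 1 + X 4) * (X 1 - X 4) + X 2 * X 3) + (X 1 + X 4) ^ (m + 4) +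
        (X 1 - X 4) ^ (m + 4) + X 2 ^ (m + 4) + C 2 * X 3 ^ (m + 4) : MvPolynomial (Fin 5) ℂ)) = 0) :
    z = z 0 • (![1, 0, 0, 0, 0] : Fin 5 → ℂ) := by
  have hodd : Odd (m + 3) := hm.add_odd ⟨1, rfl⟩
  have hd : ((m : ℂ) + 4) ≠ 0 := by exact_mod_cast Nat.succ_ne_zero (m + 3)
  have hd2 : ((m : ℂ) + 2) ≠ 0 := by exact_mod_cast Nat.succ_ne_zero (m + 1)
  have hg : ∀ j, eval z ((![C ((m : ℂ) + 2) * X 0 ^ (m + 1) * ((X 1 + X 4) * (X 1 - X 4) + X 2 * X 3),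
          C 2 * X 0 ^ (m + 2) * X 1 + C ((m : ℂ) + 4) * (X 1 + X 4) ^ (m + 3) +
            C ((m : ℂ) + 4) * (X 1 - X 4) ^ (m + 3),
          X 0 ^ (m + 2) * X 3 + C ((m : ℂ) + 4) * X 2 ^ (m + 3),
          X 0 ^ (m + 2) * X 2 + C (2 * ((m : ℂ) + 4)) * X 3 ^ (m + 3),
          -(C 2 * X 0 ^ (m + 2) * X 4) + C ((m : ℂ) + 4) * (X 1 + X 4) ^ (m + 3) -
            C ((m : ℂ) + 4) * (X 1 - X 4) ^ (m + 3)] : Fin 5 → MvPolynomial (Fin 5) ℂ) j) = 0 :=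
    fun j => by rw [← pderiv_lineForm_eq m j]; exact hgrad j
  have g0 := hg 0
  have g1 := hg 1
  have g2 := hg 2
  have g3 := hg 3
  have g4 := hg 4
  simp only [Matrix.cons_val_zero, Matrix.cons_val_one, Matrix.cons_val_two, Matrix.cons_val_three,
    Matrix.cons_val_four, Matrix.head_cons, Matrix.tail_cons, map_add, map_sub, map_neg, map_mul, map_pow,
    eval_X, eval_C] at g0 g1 g2 g3 g4
  -- the split system in `u₊ = z₁ + z₄`, `u₋ = z₁ - z₄`
  have k1 : z 0 ^ (m + 2) * (z 1 - z 4) + ((m : ℂ) + 4) * 1 * (z 1 + z 4) ^ (m + 3) = 0 := by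
    linear_combination (1 / 2 : ℂ) * g1 + (1 / 2 : ℂ) * g4
  have k2 : z 0 ^ (m + 2) * (z 1 + z 4) + ((m : ℂ) + 4) * 1 * (z 1 - z 4) ^ (m + 3) = 0 := by
    linear_combination (1 / 2 : ℂ) * g1 - (1 / 2 : ℂ) * g4
  by_cases hz0 : z 0 = 0
  · exfalso
    apply hz
    rw [hz0, zero_pow (Nat.succ_ne_zero _), zero_mul, zero_add, mul_one] at k1 k2
    rw [hz0, zero_pow (Nat.succ_ne_zero _), zero_mul, zero_add] at g2 g3
    have ep : z 1 + z 4 = 0 := (pow_eq_zero_iff (Nat.succ_ne_zero _)).1 ((mul_eq_zero.1 k1).resolve_left hd)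
    have eq : z 1 - z 4 = 0 := (pow_eq_zero_iff (Nat.succ_ne_zero _)).1 ((mul_eq_zero.1 k2).resolve_left hd)
    have e2 : z 2 = 0 := (pow_eq_zero_iff (Nat.succ_ne_zero _)).1 ((mul_eq_zero.1 g2).resolve_left hd)
    have e3 : z 3 = 0 := (pow_eq_zero_iff (Nat.succ_ne_zero _)).1
      ((mul_eq_zero.1 g3).resolve_left (mul_ne_zero two_ne_zero hd))
    have e1 : z 1 = 0 := by linear_combination (1 / 2 : ℂ) * ep + (1 / 2 : ℂ) * eq
    have e4 : z 4 = 0 := by linear_combination (1 / 2 : ℂ) * ep - (1 / 2 : ℂ) * eq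
    funext i
    fin_cases i <;> simp [hz0, e1, e2, e3, e4]
  · have hw : z 0 ^ (m + 2) ≠ 0 := pow_ne_zero _ hz0
    have hs : (z 1 + z 4) * (z 1 - z 4) + z 2 * z 3 = 0 :=
      (mul_eq_zero.1 g0).resolve_left (mul_ne_zero hd2 (pow_ne_zero _ hz0))
    obtain ⟨ep, eq, e2, e3⟩ := split_pair_eq_zero (α₁ := (1 : ℂ)) (α₂ := 1) (β₁ := 1) (β₂ := 2) hodd hw hd
      (by norm_num) k1 k2 (by rw [mul_one]; exact g2) (by rw [mul_comm (2 : ℂ) ((m : ℂ) + 4)] at g3; exact g3)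
      hs
    have e1 : z 1 = 0 := by linear_combination (1 / 2 : ℂ) * ep + (1 / 2 : ℂ) * eq
    have e4 : z 4 = 0 := by linear_combination (1 / 2 : ℂ) * ep - (1 / 2 : ℂ) * eq
    exact eq_smul_of_apply_eq (by simp) (by simp [e1]) (by simp [e2]) (by simp [e3]) (by simp [e4])

/-- **The L-node witness**: for every even `m`, the quinary form
`x₀^{m+2}((x₁+x₄)(x₁-x₄) + x₂x₃) + (x₁+x₄)^{m+4} + (x₁-x₄)^{m+4} + x₂^{m+4} + 2x₃^{m+4}` of degree `m + 4`
is ι-even and nodal with the single node `e₀ = [1:0:0:0:0]` (second conjunct of `stub_signNodalForms` at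
`d = m + 4`). -/
theorem exists_lineNodalForm (m : ℕ) (hm : Even m) :
    ∃ f : MvPolynomial (Fin 5) ℂ, f.IsHomogeneous (m + 4) ∧
      (∀ e : Fin 5 →₀ ℕ, ¬ Even (e 0 + e 1) → f.coeff e = 0) ∧
      IsNodalFormWithNodes f ![(![1, 0, 0, 0, 0] : Fin 5 → ℂ)] := by
  have hm4 : Even (m + 4) := hm.add ⟨2, rfl⟩
  refine ⟨(X 0 ^ (m + 2) * ((X 1 + X 4) * (X 1 - X 4) + X 2 * X 3) + (X 1 + X 4) ^ (m + 4) +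
        (X 1 - X 4) ^ (m + 4) + X 2 ^ (m + 4) + C 2 * X 3 ^ (m + 4) : MvPolynomial (Fin 5) ℂ), ?_, ?_, ?_⟩
  · -- homogeneous of degree `m + 4`
    have hX : ∀ i : Fin 5, (X i : MvPolynomial (Fin 5) ℂ).IsHomogeneous 1 := fun i => isHomogeneous_X ℂ i
    have hp : (X 1 + X 4 : MvPolynomial (Fin 5) ℂ).IsHomogeneous 1 := (hX 1).add (hX 4)
    have hq : (X 1 - X 4 : MvPolynomial (Fin 5) ℂ).IsHomogeneous 1 := (hX 1).sub (hX 4)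
    have hA : (X 0 ^ (m + 2) * ((X 1 + X 4) * (X 1 - X 4) + X 2 * X 3) : MvPolynomial (Fin 5) ℂ).IsHomogeneous
        (m + 4) := by
      have h := ((hX 0).pow (m + 2)).mul ((hp.mul hq).add ((hX 2).mul (hX 3)))
      rwa [show 1 * (m + 2) + (1 + 1) = m + 4 by ring] at h
    have hB : ∀ {g : MvPolynomial (Fin 5) ℂ}, g.IsHomogeneous 1 → (g ^ (m + 4)).IsHomogeneous (m + 4) :=
      fun hg => by simpa using hg.pow (m + 4)
    have hC : (C 2 * X 3 ^ (m + 4) : MvPolynomial (Fin 5) ℂ).IsHomogeneous (m + 4) := by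
      simpa using (isHomogeneous_C (Fin 5) (2 : ℂ)).mul (hB (hX 3))
    exact (((hA.add (hB hp)).add (hB hq)).add (hB (hX 2))).add hC
  · -- ι-even: fixed by `(x₀, x₁) ↦ (-x₀, -x₁)` (which maps `x₁ + x₄ ↦ -(x₁ - x₄)`)
    intro e he
    refine coeff_eq_zero_of_sign_aeval_eq _ ?_ e he
    have hm2 : Even (m + 2) := hm.add ⟨1, rfl⟩
    simp +decide only [map_add, map_sub, map_mul, map_pow, sign_aeval_X, aeval_C, algebraMap_eq, if_true,
      if_false, map_one, one_mul, map_neg, neg_one_mul, hm2.neg_pow]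
    have e1 : (-X 1 + X 4 : MvPolynomial (Fin 5) ℂ) = -(X 1 - X 4) := by ring
    have e2 : (-X 1 - X 4 : MvPolynomial (Fin 5) ℂ) = -(X 1 + X 4) := by ring
    rw [e1, e2, hm4.neg_pow, hm4.neg_pow]
    ring
  · -- nodal with the single node `e₀`
    refine ⟨fun i => ?_, fun i i' _ => Subsingleton.elim i i', fun z hz hgrad => ⟨0, z 0, ?_⟩⟩
    · rw [Matrix.cons_val_fin_one]
      refine ⟨fun h => by simpa using congr_fun h 0, fun j => ?_, rank_hessian_lineForm m⟩
      rw [pderiv_lineForm_eq m j]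
      fin_cases j <;> simp
    · rw [Matrix.cons_val_fin_one]
      exact eq_smul_of_grad_lineForm m hm z hz hgrad

/-- **The L-node witness in degree form**: for every even `d ≥ 4` an ι-even quinary form of degree `d`, nodal with
the single node `e₀` (the second conjunct of `stub_signNodalForms` verbatim, `d = m + 4`). -/
theorem exists_lineNodalForm_of_even {d : ℕ} (hd : Even d) (h4 : 4 ≤ d) :
    ∃ f : MvPolynomial (Fin 5) ℂ, f.IsHomogeneous d ∧
      (∀ e : Fin 5 →₀ ℕ, ¬ Even (e 0 + e 1) → f.coeff e = 0) ∧
      IsNodalFormWithNodes f ![(![1, 0, 0, 0, 0] : Fin 5 → ℂ)] := by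
  obtain ⟨m, rfl⟩ := Nat.exists_eq_add_of_le' h4
  exact exists_lineNodalForm m ((Nat.even_add.1 hd).2 ⟨2, rfl⟩)

end Summit.HodgeConjecture.HodgeConjecture.Theorems.SignSymmetricPowersNodalFormLine

end
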